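import Literature.Topology.FourManifolds.KirbyMovesProofs
import Literature.Topology.FourManifolds.DehnSurgeryTubularNbhdProofs
import Literature.Topology.FourManifolds.KnotsProofs
import HarnessLib

/-!
# Isotopic framed links have the same surgeries

Sibling proof file of `KirbyMoves.lean` (D-0014: named facts `def X : Prop` are discharged as
`theorem X_holds : X`). It discharges

* `Literature.FramedLink.IsSurgery.of_isIsotopic_holds : FramedLink.IsSurgery.of_isIsotopic` —
  **surgery depends only on the isotopy class of the framed link**: if the manifold `Y` (any
  model `IY`) is surgery on the framed link `L` (`L.IsSurgery IY Y`, the relational integral Dehn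
  surgery `Literature.Topology.FourManifolds.IsIntegralSurgeryLink` of `DehnSurgery.lean`) and `L'` is isotopic to `L`
  (`FramedLink.IsIsotopic`: one ambient isotopy `F` of `S³` with `F 1 ∘ Lᵢ = L'ᵢ` for every
  component, and equal framing integers), then `Y` is surgery on `L'`;
* `Literature.IsIntegralSurgery.of_isIsotopic_holds : IsIntegralSurgery.of_isIsotopic` — the same for a
  framed knot (`DehnSurgery.lean`: if `Y` is `m`-surgery on `K` and `K'` is isotopic to `K` then
  `Y` is `m`-surgery on `K'`), by the same transport (`IsIntegralSurgery.isoTransport`).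

This is leaf (I) of the decomposition of Kirby's theorem ("if" direction,
`Literature.Topology.FourManifolds.KirbyEquivalent.nonempty_diffeomorph`) recorded in `KirbyMovesSurgery.lean`; the file does
not depend on that sibling.

## Source

Rolfsen, *Knots and Links* (1976), §9.F: the surgered manifold is determined by the knot (link)
type and the framing; Gompf–Stipsicz, *4-Manifolds and Kirby Calculus* (1999), §5.3. The sources
treat the statement as part of the definition; the proof below is the transport of a surgery
presentation along the final diffeomorphism `F 1` of the ambient isotopy, the only non-formal
point being that `F 1` preserves the orientation convention `det_pos` of
`Literature.Topology.FourManifolds.Knot.TubularNbhd` — proved here by continuity along the isotopy.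

## Proof

Let `(ν, jA, jB)` present `Y` as surgery on `L` and let `Φ = F t` be a stage of the ambient
isotopy (`t = 1` at the end).

* **Orientation along the isotopy** (`Literature.Topology.FourManifolds.Knot.TubularNbhd.tubeFrameDet_isoStage_pos`). For a
  tubular neighbourhood `ν` put `G_t (s, v) = F t (ν (circlePoint s, v)) ∈ ℝ⁴`; the determinant
  `g (t) = det (G_t, ∂_s G_t, ∂_{v₀} G_t, ∂_{v₁} G_t) (q)` of the field `det_pos`
  (`Literature.Topology.FourManifolds.tubeFrameDet`, `tubeFrameDet_eq_det_deriv` of `DehnSurgeryTubularNbhdProofs.lean`) is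
  (a) continuous in `t`, the rows being values of the continuous derivative of the jointly smooth
  map `(t, q) ↦ G_t q` (`contDiff_isoMap`, `fderiv_isoStage`, `continuous_tubeFrameDet_isoStage`);
  (b) never zero: by the chain rule `dG_t = dι ∘ d(F t) ∘ dν` (`mfderiv_isoStage_eq_comp`) with
  `dν` injective (`mfderiv_param_injective`, from `det_pos` of `ν` via
  `fderiv_injective_of_tubeFrameDet_ne_zero`), `d(F t)` bijective (a local diffeomorphism,
  `Diffeomorph.mfderivToContinuousLinearEquiv`) and `dι` injective with range `(F t (ν q))ᗮ`
  (Mathlib `mfderiv_coe_sphere_injective`, `range_mfderiv_coe_sphere`), the three derivative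
  rows are independent and orthogonal to the unit position row, so the determinant is nonzero
  (`frameDet_ne_zero_of_injective`); (c) positive at `t = 0` where `F 0 = id`. By the
  intermediate value theorem `g (t) > 0` for all `t`: `F t ∘ ν` satisfies `det_pos`
  (`det_pos_isoStage`).
* `Literature.Topology.FourManifolds.Knot.TubularNbhd.isoTransport`: `Φ ∘ νᵢ` is an oriented tubular neighbourhood of
  `L'ᵢ = Φ ∘ Lᵢ` (smooth embedding by the tree's `Manifold.IsSmoothEmbedding.diffeomorph_comp`),
  with the same image up to `Φ`, hence the family stays pairwise disjoint.
* `Literature.Topology.FourManifolds.Knot.TubularNbhd.HasFraming.isoTransport`: it has the same framing integer — `Φ` restricts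
  to a map of complements `S³ ∖ Lᵢ → S³ ∖ L'ᵢ` (`Knot.isoComplMap`) carrying meridian to meridian
  and longitude to longitude (`meridian_isoTransport`, `longitude_isoTransport`, definitionally),
  so the induced homomorphism of abelianised fundamental groups (`FundamentalGroup.mapOfEq`,
  `Abelianization.map`) carries `[λ] = m • [μ]` to the same relation for `Φ ∘ νᵢ`.
* `Literature.Topology.FourManifolds.Link.isoComplDiffeo`: `Φ⁻¹` restricts to a diffeomorphism `S³ ∖ L' → S³ ∖ L` of the open
  submanifolds; the new embedding of the link complement is `jA ∘ Φ⁻¹` (a smooth embedding by the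
  tree's `Manifold.IsSmoothEmbedding.comp_diffeomorph`, same image), the solid tori are kept, and
  the surgery relation of `Φ ∘ νᵢ` at `a'` is that of `νᵢ` at `Φ⁻¹ a'`
  (`Literature.Topology.FourManifolds.FramedLink.IsSurgery.isoTransport`). With `t = 1` and the equality of framings this is
  `IsSurgery.of_isIsotopic'`, whence `of_isIsotopic_holds`.

## References

* D. Rolfsen, *Knots and Links*, Publish or Perish (1976), §9.F. [cite: Rolfsen1976, §9.F]
* R. E. Gompf, A. I. Stipsicz, *4-Manifolds and Kirby Calculus*, AMS GSM 20 (1999), §5.3.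
  [cite: GompfStipsicz1999, §5.3]
* M. W. Hirsch, *Differential Topology*, GTM 33, Springer (1976), §8.1 (ambient isotopy).
  [cite: Hirsch1976, §8.1]
-/

open scoped Manifold ContDiff Topology RealInnerProductSpace
open Function Set

noncomputable section

universe u v w u'

namespace Literature.Topology.FourManifolds

/-- Local notation: `𝔼 n` is the model Euclidean space `EuclideanSpace ℝ (Fin n)`. -/
local notation "𝔼 " n:arg => EuclideanSpace ℝ (Fin n)

/-- Local notation: `𝕊 n` is the unit sphere in `EuclideanSpace ℝ (Fin (n + 1))`. -/
local notation "𝕊 " n:arg => (Metric.sphere (0 : EuclideanSpace ℝ (Fin (n + 1))) 1)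

attribute [local instance] fact_finrank_euclideanSpace_two fact_finrank_euclideanSpace_four

/-! ## A frame determinant criterion -/

/-- **Injective Jacobians on the sphere have nonvanishing frame determinant.** If `p ∈ ℝ⁴` is a
unit vector and `L : ℝ × ℝ² → ℝ⁴` is an injective linear map with values orthogonal to `p`, then
`det (p, L (1, 0), L (0, e₀), L (0, e₁)) ≠ 0`. [folklore] -/
theorem frameDet_ne_zero_of_injective {p : 𝔼 4} (hp : ‖p‖ = 1) {L : ℝ × 𝔼 2 →L[ℝ] 𝔼 4}
    (hL : Injective L) (horth : ∀ x, ⟪L x, p⟫ = 0) :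
    frameDet p (L (1, 0)) (L (0, EuclideanSpace.single 0 1)) (L (0, EuclideanSpace.single 1 1)) ≠ 0 := by
  intro h0
  unfold frameDet at h0
  obtain ⟨v, hv, hvM⟩ := Matrix.exists_vecMul_eq_zero_iff.2 h0
  -- the linear relation between the four rows
  have hrel : v 0 • p + v 1 • L (1, 0) + v 2 • L (0, EuclideanSpace.single 0 1) +
      v 3 • L (0, EuclideanSpace.single 1 1) = 0 := by
    ext j
    have := congrFun hvM j
    simp [Matrix.vecMul, dotProduct, Fin.sum_univ_four] at this
    simpa using this
  -- pairing with `p` kills the last three terms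
  have h0' : v 0 = 0 := by
    have := congrArg (fun x ↦ ⟪x, p⟫) hrel
    simp only [inner_add_left, inner_smul_left, horth, mul_zero, add_zero, inner_zero_left,
      real_inner_self_eq_norm_sq, hp, one_pow, mul_one, RCLike.conj_to_real] at this
    exact this
  rw [h0', zero_smul, zero_add, ← map_smul, ← map_smul, ← map_smul, ← map_add, ← map_add,
    map_eq_zero_iff L hL] at hrel
  have h1 : v 1 = 0 := by simpa using congrArg Prod.fst hrel
  have h23 := congrArg Prod.snd hrel
  simp only [Prod.snd_add, Prod.smul_snd, smul_zero, zero_add] at h23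
  have h2 : v 2 = 0 := by simpa using congrArg (fun w : 𝔼 2 ↦ w 0) h23
  have h3 : v 3 = 0 := by simpa using congrArg (fun w : 𝔼 2 ↦ w 1) h23
  apply hv
  ext i
  fin_cases i <;> assumption

/-! ## Orientation along an ambient isotopy -/

namespace Knot.TubularNbhd

variable {K : 𝕊 1 → 𝕊 3} (ν : Knot.TubularNbhd K)

/-- The tubular neighbourhood in the angle coordinate: `(s, v) ↦ ν (circlePoint s, v)`. [folklore] -/
def param (q : ℝ × 𝔼 2) : 𝕊 3 := ν (circlePoint q.1, q.2)

/-- Unfolding of `param`. [folklore] -/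
theorem param_apply (q : ℝ × 𝔼 2) : ν.param q = ν (circlePoint q.1, q.2) := rfl

/-- The angle-coordinate tubular neighbourhood is smooth. [folklore] -/
theorem contMDiff_param : ContMDiff 𝓘(ℝ, ℝ × 𝔼 2) (𝓡 3) ∞ ν.param := by
  have h1 : ContMDiff 𝓘(ℝ, ℝ × 𝔼 2) 𝓘(ℝ, ℝ) ∞ (fun q : ℝ × 𝔼 2 ↦ q.1) :=
    (ContinuousLinearMap.fst ℝ ℝ (𝔼 2)).contMDiff
  have h2 : ContMDiff 𝓘(ℝ, ℝ × 𝔼 2) 𝓘(ℝ, 𝔼 2) ∞ (fun q : ℝ × 𝔼 2 ↦ q.2) :=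
    (ContinuousLinearMap.snd ℝ ℝ (𝔼 2)).contMDiff
  exact ν.contMDiff.comp ((contMDiff_circlePoint.comp h1).prodMk h2)

variable (F : AmbientIsotopy (𝓡 3) (𝕊 3))

/-- The **frame map of the isotopy**: `(t, (s, v)) ↦ F t (ν (circlePoint s, v)) ∈ ℝ⁴`. [folklore] -/
def isoMap (x : ℝ × (ℝ × 𝔼 2)) : 𝔼 4 := ((F.toFun x.1 (ν.param x.2) : 𝕊 3) : 𝔼 4)

/-- Unfolding of `isoMap`. [folklore] -/
theorem isoMap_apply (t : ℝ) (q : ℝ × 𝔼 2) :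
    ν.isoMap F (t, q) = ((F.toFun t (ν (circlePoint q.1, q.2)) : 𝕊 3) : 𝔼 4) := rfl

/-- The frame map of the isotopy is smooth (jointly in time and space). [folklore] -/
theorem contDiff_isoMap : ContDiff ℝ ∞ (ν.isoMap F) := by
  rw [← contMDiff_iff_contDiff]
  have h1 : ContMDiff 𝓘(ℝ, ℝ × (ℝ × 𝔼 2)) 𝓘(ℝ, ℝ) ∞ (fun x : ℝ × (ℝ × 𝔼 2) ↦ x.1) :=
    (ContinuousLinearMap.fst ℝ ℝ (ℝ × 𝔼 2)).contMDiff
  have h2 : ContMDiff 𝓘(ℝ, ℝ × (ℝ × 𝔼 2)) 𝓘(ℝ, ℝ × 𝔼 2) ∞ (fun x : ℝ × (ℝ × 𝔼 2) ↦ x.2) :=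
    (ContinuousLinearMap.snd ℝ ℝ (ℝ × 𝔼 2)).contMDiff
  have h3 : ContMDiff 𝓘(ℝ, ℝ × (ℝ × 𝔼 2)) (𝓘(ℝ, ℝ).prod (𝓡 3)) ∞
      (fun x : ℝ × (ℝ × 𝔼 2) ↦ (x.1, ν.param x.2)) := h1.prodMk (ν.contMDiff_param.comp h2)
  exact contMDiff_coe_sphere.comp (F.contMDiff.comp h3)

/-- The stage-`t` frame map `q ↦ F t (ν (circlePoint q.1, q.2))`. [folklore] -/
def isoStage (t : ℝ) (q : ℝ × 𝔼 2) : 𝔼 4 := ν.isoMap F (t, q)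

/-- Unfolding of `isoStage`. [folklore] -/
theorem isoStage_apply (t : ℝ) (q : ℝ × 𝔼 2) :
    ν.isoStage F t q = ((F.toFun t (ν (circlePoint q.1, q.2)) : 𝕊 3) : 𝔼 4) := rfl

/-- The stage map is the composition `Subtype.val ∘ F t ∘ param`. [folklore] -/
theorem isoStage_eq_comp (t : ℝ) :
    ν.isoStage F t = (Subtype.val ∘ F.toFun t) ∘ ν.param := rfl

/-- The stage maps are smooth. [folklore] -/
theorem contDiff_isoStage (t : ℝ) : ContDiff ℝ ∞ (ν.isoStage F t) :=
  (ν.contDiff_isoMap F).comp (contDiff_prodMk_right t)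

/-- The stage maps are differentiable. [folklore] -/
theorem differentiable_isoStage (t : ℝ) : Differentiable ℝ (ν.isoStage F t) :=
  (ν.contDiff_isoStage F t).differentiable (by simp)

/-- The spatial derivative of the stage map is a partial derivative of the frame map. [folklore] -/
theorem fderiv_isoStage (t : ℝ) (q : ℝ × 𝔼 2) (y : ℝ × 𝔼 2) :
    fderiv ℝ (ν.isoStage F t) q y = fderiv ℝ (ν.isoMap F) (t, q) (0, y) := by
  have hd : DifferentiableAt ℝ (ν.isoMap F) (t, q) :=
    ((ν.contDiff_isoMap F).differentiable (by simp)) _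
  have : ν.isoStage F t = ν.isoMap F ∘ fun q ↦ (t, q) := rfl
  rw [this, fderiv_comp q hd (differentiableAt_const _ |>.prodMk differentiableAt_id),
    (hasFDerivAt_prodMk_right (𝕜 := ℝ) t q).fderiv]
  rfl

/-- The frame determinant of the stage maps, at a fixed point, is continuous in time. [folklore] -/
theorem continuous_tubeFrameDet_isoStage (q : ℝ × 𝔼 2) :
    Continuous fun t ↦ tubeFrameDet (ν.isoStage F t) q := by
  have hc : Continuous (fderiv ℝ (ν.isoMap F)) :=
    (ν.contDiff_isoMap F).continuous_fderiv (by simp)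
  have hq : Continuous fun t : ℝ ↦ (t, q) := continuous_id.prodMk continuous_const
  simp only [tubeFrameDet_def, fderiv_isoStage]
  refine continuous_frameDet ((ν.contDiff_isoMap F).continuous.comp hq) ?_ ?_ ?_ <;>
    exact (hc.comp hq).clm_apply continuous_const


/-! ### The zero section of the family: the frame of `ν` itself -/

/-- The tubular neighbourhood in the angle coordinate, with values in `ℝ⁴`. [folklore] -/
def paramCoe (q : ℝ × 𝔼 2) : 𝔼 4 := ((ν.param q : 𝕊 3) : 𝔼 4)

/-- The `ℝ⁴`-valued angle-coordinate neighbourhood is `Subtype.val ∘ param`. [folklore] -/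
theorem paramCoe_eq_comp : ν.paramCoe = Subtype.val ∘ ν.param := rfl

/-- The `ℝ⁴`-valued angle-coordinate neighbourhood is smooth. [folklore] -/
theorem contDiff_paramCoe : ContDiff ℝ ∞ ν.paramCoe := by
  rw [← contMDiff_iff_contDiff, paramCoe_eq_comp]
  exact contMDiff_coe_sphere.comp ν.contMDiff_param

/-- The frame determinant of `ν` in the angle coordinate is the determinant of `det_pos`, hence
positive. [folklore] -/
theorem tubeFrameDet_paramCoe_pos (q : ℝ × 𝔼 2) : 0 < tubeFrameDet ν.paramCoe q := by
  obtain ⟨θ, w⟩ := q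
  rw [tubeFrameDet_eq_det_deriv (ν.contDiff_paramCoe.differentiable (by simp))]
  exact ν.det_pos θ w

/-- Chain rule for `paramCoe = Subtype.val ∘ param`. [folklore] -/
theorem mfderiv_paramCoe (q : ℝ × 𝔼 2) : mfderiv 𝓘(ℝ, ℝ × 𝔼 2) 𝓘(ℝ, 𝔼 4) ν.paramCoe q =
    (mfderiv (𝓡 3) 𝓘(ℝ, 𝔼 4) (Subtype.val : 𝕊 3 → 𝔼 4) (ν.param q)).comp
      (mfderiv 𝓘(ℝ, ℝ × 𝔼 2) (𝓡 3) ν.param q) := by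
  have hn : (∞ : WithTop ℕ∞) ≠ 0 := by simp
  rw [paramCoe_eq_comp]
  exact mfderiv_comp q (contMDiff_coe_sphere.mdifferentiableAt hn)
    (ν.contMDiff_param.mdifferentiableAt hn)

/-- **The differential of a tubular neighbourhood is injective** (in the angle coordinate): the
frame determinant of `det_pos` does not vanish. [folklore] -/
theorem mfderiv_param_injective (q : ℝ × 𝔼 2) :
    Injective (mfderiv 𝓘(ℝ, ℝ × 𝔼 2) (𝓡 3) ν.param q) := by
  have h : Injective (mfderiv 𝓘(ℝ, ℝ × 𝔼 2) 𝓘(ℝ, 𝔼 4) ν.paramCoe q) := by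
    rw [mfderiv_eq_fderiv]
    exact fderiv_injective_of_tubeFrameDet_ne_zero (ν.tubeFrameDet_paramCoe_pos q).ne'
  rw [mfderiv_paramCoe] at h
  exact Injective.of_comp
    (f := ⇑(mfderiv (𝓡 3) 𝓘(ℝ, 𝔼 4) (Subtype.val : 𝕊 3 → 𝔼 4) (ν.param q))) h

/-! ### Nonvanishing and positivity along the isotopy -/

/-- The stage map at time `0` is `ν` itself (`F 0 = id`). [folklore] -/
theorem isoStage_zero : ν.isoStage F 0 = ν.paramCoe := by
  funext q
  rw [isoStage_apply, F.map_zero]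
  rfl

/-- Chain rule for the stage map `Subtype.val ∘ F t ∘ param`. [folklore] -/
theorem mfderiv_isoStage_eq_comp (t : ℝ) (q : ℝ × 𝔼 2) :
    mfderiv 𝓘(ℝ, ℝ × 𝔼 2) 𝓘(ℝ, 𝔼 4) (ν.isoStage F t) q =
    ((mfderiv (𝓡 3) 𝓘(ℝ, 𝔼 4) (Subtype.val : 𝕊 3 → 𝔼 4) (F.toFun t (ν.param q))).comp
      (mfderiv (𝓡 3) (𝓡 3) (F.toFun t) (ν.param q))).comp
      (mfderiv 𝓘(ℝ, ℝ × 𝔼 2) (𝓡 3) ν.param q) := by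
  have hn : (∞ : WithTop ℕ∞) ≠ 0 := by simp
  rw [isoStage_eq_comp,
    mfderiv_comp q ((contMDiff_coe_sphere.comp (F.contMDiff_toFun t)).mdifferentiableAt hn)
      (ν.contMDiff_param.mdifferentiableAt hn),
    mfderiv_comp (ν.param q) (contMDiff_coe_sphere.mdifferentiableAt hn)
      ((F.contMDiff_toFun t).mdifferentiableAt hn)]
  rfl

/-- **The frame determinant never vanishes along the isotopy**: at time `t` the three derivative
rows are the images of a basis under the injective linear map
`d(ι ∘ F t ∘ ν) = dι ∘ dF_t ∘ dν` (`ν` an immersion by `det_pos`, `F t` a local diffeomorphism,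
`ι : 𝕊 3 ⊆ ℝ⁴` an immersion), all orthogonal to the unit position vector `F t (ν q)`; so the
four rows are linearly independent (`frameDet_ne_zero_of_injective`). [folklore] -/
theorem tubeFrameDet_isoStage_ne_zero (t : ℝ) (q : ℝ × 𝔼 2) :
    tubeFrameDet (ν.isoStage F t) q ≠ 0 := by
  have hn : (∞ : WithTop ℕ∞) ≠ 0 := by simp
  rw [tubeFrameDet_def, ← mfderiv_eq_fderiv, mfderiv_isoStage_eq_comp]
  -- the three differentials
  set A := mfderiv (𝓡 3) 𝓘(ℝ, 𝔼 4) (Subtype.val : 𝕊 3 → 𝔼 4) (F.toFun t (ν.param q)) with hA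
  set B := mfderiv (𝓡 3) (𝓡 3) (F.toFun t) (ν.param q) with hB
  set C := mfderiv 𝓘(ℝ, ℝ × 𝔼 2) (𝓡 3) ν.param q with hC
  have hAi : Injective A := mfderiv_coe_sphere_injective (n := 3) _
  have hBi : Injective B :=
    ((F.toDiffeomorph t).mfderivToContinuousLinearEquiv hn (ν.param q)).injective
  have hCi : Injective C := ν.mfderiv_param_injective q
  refine frameDet_ne_zero_of_injective (norm_eq_of_mem_sphere _)
    (show Injective (⇑A ∘ ⇑B ∘ ⇑C) from (hAi.comp hBi).comp hCi) fun x ↦ ?_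
  have hmem : A (B (C x)) ∈ (A : TangentSpace (𝓡 3) (F.toFun t (ν.param q)) →L[ℝ] 𝔼 4).range :=
    ⟨B (C x), rfl⟩
  rw [hA, range_mfderiv_coe_sphere] at hmem
  exact (Submodule.mem_orthogonal_singleton_iff_inner_left).1 hmem

/-- The frame determinant at time `0` is that of `ν`, hence positive. [folklore] -/
theorem tubeFrameDet_isoStage_zero_pos (q : ℝ × 𝔼 2) : 0 < tubeFrameDet (ν.isoStage F 0) q := by
  rw [isoStage_zero]
  exact ν.tubeFrameDet_paramCoe_pos q

/-- **Ambient isotopies preserve the orientation of tubular neighbourhoods**: the frame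
determinant of `F t ∘ ν` is positive for all times `t` — it is continuous in `t`
(`continuous_tubeFrameDet_isoStage`), never zero (`tubeFrameDet_isoStage_ne_zero`) and positive
at `t = 0` (intermediate value theorem). [folklore] -/
theorem tubeFrameDet_isoStage_pos (t : ℝ) (q : ℝ × 𝔼 2) : 0 < tubeFrameDet (ν.isoStage F t) q := by
  by_contra hle
  rw [not_lt] at hle
  obtain ⟨s, hs⟩ : ∃ s, tubeFrameDet (ν.isoStage F s) q = 0 :=
    intermediate_value_univ t 0 (ν.continuous_tubeFrameDet_isoStage F q)
      ⟨hle, (ν.tubeFrameDet_isoStage_zero_pos F q).le⟩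
  exact ν.tubeFrameDet_isoStage_ne_zero F s q hs

/-- The orientation condition `det_pos` for the transported map `F t ∘ ν`. [folklore] -/
theorem det_pos_isoStage (t θ : ℝ) (w : 𝔼 2) : 0 < Matrix.det (Matrix.of
    ![⇑((F.toFun t (ν (circlePoint θ, w)) : 𝕊 3) : 𝔼 4),
      ⇑(deriv (fun s : ℝ ↦ ((F.toFun t (ν (circlePoint s, w)) : 𝕊 3) : 𝔼 4)) θ),
      ⇑(deriv (fun s : ℝ ↦ ((F.toFun t (ν (circlePoint θ, w + EuclideanSpace.single 0 s)) :
        𝕊 3) : 𝔼 4)) 0),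
      ⇑(deriv (fun s : ℝ ↦ ((F.toFun t (ν (circlePoint θ, w + EuclideanSpace.single 1 s)) :
        𝕊 3) : 𝔼 4)) 0)]) := by
  have := ν.tubeFrameDet_isoStage_pos F t (θ, w)
  rwa [tubeFrameDet_eq_det_deriv (ν.differentiable_isoStage F t)] at this


/-! ## Transport of a tubular neighbourhood along an ambient isotopy -/

/-- **The transported tubular neighbourhood.** If `F` is an ambient isotopy of `𝕊 3` whose
stage `t` carries the knot `K` to `K'` (`F t ∘ K = K'`), then `F t ∘ ν` is an oriented tubular
neighbourhood of `K'`: a smooth embedding (a diffeomorphism after a smooth embedding, the tree's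
`Manifold.IsSmoothEmbedding.diffeomorph_comp`), extending `K'`, and positively oriented by
`det_pos_isoStage`. Rolfsen (1976), §9.F (surgery depends only on the knot type); Hirsch (1976),
§8.1. [cite: Rolfsen1976, §9.F] -/
def isoTransport (t : ℝ) {K' : 𝕊 1 → 𝕊 3} (hK : ∀ x, F.toFun t (K x) = K' x) :
    Knot.TubularNbhd K' where
  toFun p := F.toFun t (ν p)
  isSmoothEmbedding := by
    have : (fun p : (𝕊 1) × (𝔼 2) ↦ F.toFun t (ν p)) = ⇑(F.toDiffeomorph t) ∘ ⇑ν := rfl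
    rw [this]
    exact ν.isSmoothEmbedding_coe.diffeomorph_comp (F.toDiffeomorph t)
  apply_zero x := by
    change F.toFun t (ν (x, 0)) = K' x
    rw [ν.coe_apply_zero, hK]
  det_pos θ w := ν.det_pos_isoStage F t θ w

/-- The transported tubular neighbourhood as a function. [folklore] -/
@[simp] theorem isoTransport_apply (t : ℝ) {K' : 𝕊 1 → 𝕊 3} (hK : ∀ x, F.toFun t (K x) = K' x)
    (p : (𝕊 1) × (𝔼 2)) : ν.isoTransport F t hK p = F.toFun t (ν p) := rfl

/-- The image of the transported tubular neighbourhood. [folklore] -/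
theorem range_isoTransport (t : ℝ) {K' : 𝕊 1 → 𝕊 3} (hK : ∀ x, F.toFun t (K x) = K' x) :
    range ⇑(ν.isoTransport F t hK) = F.toFun t '' range ⇑ν := by
  rw [← range_comp]
  rfl

end Knot.TubularNbhd

/-! ## The framing of the transported tubular neighbourhood -/

namespace Knot

/-- A stage of an ambient isotopy carrying the knot `K` to `K'` maps the complement of `K` into the
complement of `K'` (it is injective), as a continuous map. [folklore] -/
def isoComplMap (F : AmbientIsotopy (𝓡 3) (𝕊 3)) (t : ℝ) {K K' : Knot}
    (hK : ∀ x, F.toFun t (K x) = K' x) : C(K.complement, K'.complement) where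
  toFun a := ⟨F.toFun t a, by
    rw [SphereEmbedding.mem_complement_iff]
    rintro ⟨y, hy⟩
    rw [← hK] at hy
    exact a.2 ⟨y, (F.bijective t).1 hy⟩⟩
  continuous_toFun := ((F.contMDiff_toFun t).continuous.comp continuous_subtype_val).subtype_mk _

/-- The complement map on points. [folklore] -/
@[simp] theorem coe_isoComplMap_apply (F : AmbientIsotopy (𝓡 3) (𝕊 3)) (t : ℝ) {K K' : Knot}
    (hK : ∀ x, F.toFun t (K x) = K' x) (a : K.complement) :
    (isoComplMap F t hK a : 𝕊 3) = F.toFun t a := rfl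

namespace TubularNbhd

variable {K K' : Knot} (ν : Knot.TubularNbhd K) (F : AmbientIsotopy (𝓡 3) (𝕊 3)) (t : ℝ)
  (hK : ∀ x, F.toFun t (K x) = K' x)

/-- The base point of the transported tubular neighbourhood is the image of the base point. [folklore] -/
theorem isoComplMap_basePoint :
    isoComplMap F t hK ν.basePoint = (ν.isoTransport F t hK).basePoint := rfl

/-- The meridian of the transported tubular neighbourhood is the image of the meridian. [folklore] -/
theorem meridian_isoTransport : (ν.isoTransport F t hK).meridian =
    (ν.meridian.map (isoComplMap F t hK).continuous).cast (ν.isoComplMap_basePoint F t hK).symm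
      (ν.isoComplMap_basePoint F t hK).symm := by
  apply Path.ext
  funext s
  rfl

/-- The longitude of the transported tubular neighbourhood is the image of the longitude. [folklore] -/
theorem longitude_isoTransport : (ν.isoTransport F t hK).longitude =
    (ν.longitude.map (isoComplMap F t hK).continuous).cast (ν.isoComplMap_basePoint F t hK).symm
      (ν.isoComplMap_basePoint F t hK).symm := by
  apply Path.ext
  funext s
  rfl

/-- In the fundamental group of the complement of `K'`, the class of a transported loop is the
image of its class under the induced homomorphism. [folklore] -/
theorem fromPath_mk_cast_map {b' : K'.complement} (γ : Path ν.basePoint ν.basePoint)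
    (hb : isoComplMap F t hK ν.basePoint = b') :
    FundamentalGroup.fromPath (Path.Homotopic.Quotient.mk
      ((γ.map (isoComplMap F t hK).continuous).cast hb.symm hb.symm)) =
      FundamentalGroup.mapOfEq (isoComplMap F t hK) hb
        (FundamentalGroup.fromPath (Path.Homotopic.Quotient.mk γ)) := by
  rw [FundamentalGroup.mapOfEq_apply, Path.Homotopic.Quotient.mk_cast, Path.Homotopic.Quotient.mk_map]

/-- **Ambient isotopies preserve framings**: if `ν` has framing `m` then the transported tubular
neighbourhood `F t ∘ ν` of `K' = F t ∘ K` has framing `m` — the relation `[λ] = m • [μ]` in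
`π₁(S³ ∖ K)ᵃᵇ` is carried to `π₁(S³ ∖ K')ᵃᵇ` by the homomorphism induced by `F t` on the
complements, which maps meridian to meridian and longitude to longitude
(`meridian_isoTransport`, `longitude_isoTransport`). Rolfsen (1976), §9.F; Gompf–Stipsicz (1999),
§5.3. [cite: Rolfsen1976, §9.F] -/
theorem HasFraming.isoTransport {m : ℤ} (h : ν.HasFraming m) :
    (ν.isoTransport F t hK).HasFraming m := by
  unfold HasFraming at h ⊢
  set G := FundamentalGroup.mapOfEq (isoComplMap F t hK) (ν.isoComplMap_basePoint F t hK) with hG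
  have h' := congrArg (Abelianization.map G) h
  simp only [map_zpow, Abelianization.map_of] at h'
  rw [ν.meridian_isoTransport, ν.longitude_isoTransport,
    ν.fromPath_mk_cast_map F t hK _ (ν.isoComplMap_basePoint F t hK),
    ν.fromPath_mk_cast_map F t hK _ (ν.isoComplMap_basePoint F t hK), ← hG, h']

end TubularNbhd

end Knot

/-! ## Isotopic framed links have the same surgeries -/

namespace Link

variable {ι : Type*} [Finite ι]

/-- A stage of an ambient isotopy carrying the link `L` to `L'` restricts to a diffeomorphism of
the link complements; here its inverse `S³ ∖ L' → S³ ∖ L`, as a diffeomorphism of the open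
submanifolds. [folklore] -/
def isoComplDiffeo (F : AmbientIsotopy (𝓡 3) (𝕊 3)) (t : ℝ) {L L' : Link ι}
    (hL : ∀ i x, F.toFun t (L.component i x) = L'.component i x) :
    L'.complement ≃ₘ⟮𝓡 3, 𝓡 3⟯ L.complement where
  toFun a := ⟨(F.toDiffeomorph t).symm a, by
    rw [mem_complement_iff]
    rintro i ⟨y, hy⟩
    have := congrArg (F.toDiffeomorph t) hy
    rw [Diffeomorph.apply_symm_apply, AmbientIsotopy.coe_toDiffeomorph, hL] at this
    exact (mem_complement_iff L' a).1 a.2 i ⟨y, this⟩⟩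
  invFun a := ⟨F.toDiffeomorph t a, by
    rw [mem_complement_iff]
    rintro i ⟨y, hy⟩
    rw [AmbientIsotopy.coe_toDiffeomorph, ← hL] at hy
    exact (mem_complement_iff L a).1 a.2 i ⟨y, (F.bijective t).1 hy⟩⟩
  left_inv a := Subtype.ext ((F.toDiffeomorph t).apply_symm_apply _)
  right_inv a := Subtype.ext ((F.toDiffeomorph t).symm_apply_apply _)
  contMDiff_toFun := (ContMDiff.subtypeVal_comp_iff L.complement _).1
    ((F.toDiffeomorph t).symm.contMDiff.comp contMDiff_subtype_val)
  contMDiff_invFun := (ContMDiff.subtypeVal_comp_iff L'.complement _).1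
    ((F.toDiffeomorph t).contMDiff.comp contMDiff_subtype_val)

/-- The complement diffeomorphism on points: it is `(F t)⁻¹`. [folklore] -/
@[simp] theorem coe_isoComplDiffeo_apply (F : AmbientIsotopy (𝓡 3) (𝕊 3)) (t : ℝ) {L L' : Link ι}
    (hL : ∀ i x, F.toFun t (L.component i x) = L'.component i x) (a : L'.complement) :
    (isoComplDiffeo F t hL a : 𝕊 3) = (F.toDiffeomorph t).symm a := rfl

/-- Precomposing with the complement diffeomorphism does not change the image. [folklore] -/
theorem range_comp_isoComplDiffeo {Y : Type*} (F : AmbientIsotopy (𝓡 3) (𝕊 3)) (t : ℝ)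
    {L L' : Link ι} (hL : ∀ i x, F.toFun t (L.component i x) = L'.component i x)
    (f : L.complement → Y) : range (f ∘ isoComplDiffeo F t hL) = range f :=
  (EquivLike.surjective (isoComplDiffeo F t hL)).range_comp f

end Link

namespace FramedLink

/-- **Surgery is transported along a stage of an ambient isotopy** (same manifold, same model):
if `Y` is surgery on `L` and the stage `F t` carries `L` to `L'` (componentwise, framings equal),
then `Y` is surgery on `L'` — transport the tubular neighbourhoods (`Knot.TubularNbhd.isoTransport`,
oriented by `det_pos_isoStage`, framings by `HasFraming.isoTransport`), precompose the embedding of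
the link complement with `(F t)⁻¹` (`Link.isoComplDiffeo`), keep the solid tori. Rolfsen (1976),
§9.F; Gompf–Stipsicz (1999), §5.3. [cite: Rolfsen1976, §9.F] -/
theorem IsSurgery.isoTransport {EY HY : Type*} [NormedAddCommGroup EY] [NormedSpace ℝ EY]
    [TopologicalSpace HY] {IY : ModelWithCorners ℝ EY HY} {Y : Type*} [TopologicalSpace Y]
    [ChartedSpace HY Y] {ι : Type*} [Finite ι] {L L' : FramedLink ι} (h : L.IsSurgery IY Y)
    (F : AmbientIsotopy (𝓡 3) (𝕊 3)) (t : ℝ)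
    (hL : ∀ i x, F.toFun t (L.component i x) = L'.component i x) (hfr : L.framing = L'.framing) :
    L'.IsSurgery IY Y := by
  obtain ⟨ν, hν, hdisj, jA, jB, hA, hAo, hB, hcov, hBdisj, hglue⟩ := h
  refine ⟨fun i ↦ (ν i).isoTransport F t (hL i), fun i ↦ ?_, fun i j hij ↦ ?_, ?_⟩
  · rw [← hfr]
    exact Knot.TubularNbhd.HasFraming.isoTransport (ν i) F t (hL i) (hν i)
  · change Disjoint (range ⇑((ν i).isoTransport F t (hL i))) (range ⇑((ν j).isoTransport F t (hL j)))
    rw [Knot.TubularNbhd.range_isoTransport, Knot.TubularNbhd.range_isoTransport]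
    exact (Set.disjoint_image_iff (F.bijective t).1).2 (hdisj hij)
  simp only [Link.surgeryRel]
  refine ⟨jA ∘ Link.isoComplDiffeo F t hL, jB, hA.comp_diffeomorph _, ?_, hB, ?_, hBdisj,
    fun i a b ↦ ?_⟩
  · rw [Link.range_comp_isoComplDiffeo]
    exact hAo
  · rw [Link.range_comp_isoComplDiffeo]
    exact hcov
  · rw [comp_apply, hglue i (Link.isoComplDiffeo F t hL a) b]
    change (ν i).glueRel ((F.toDiffeomorph t).symm a) b ↔
      ((ν i).isoTransport F t (hL i)).glueRel a b
    constructor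
    · rintro ⟨u, s, hs, hb, ha⟩
      refine ⟨u, s, hs, hb, ?_⟩
      have := congrArg (F.toDiffeomorph t) ha
      rwa [Diffeomorph.apply_symm_apply] at this
    · rintro ⟨u, s, hs, hb, ha⟩
      refine ⟨u, s, hs, hb, ?_⟩
      rw [Knot.TubularNbhd.isoTransport_apply, ← AmbientIsotopy.coe_toDiffeomorph] at ha
      rw [ha, Diffeomorph.symm_apply_apply]

/-- **Isotopic framed links have the same surgeries** — discharge form of the named fact
`FramedLink.IsSurgery.of_isIsotopic` (`KirbyMoves.lean`) for one pair of framed links: if `Y` is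
surgery on `L` and `L'` is isotopic to `L` (one ambient isotopy of `S³` carrying every component
of `L` to the corresponding component of `L'`, equal framings), then `Y` is surgery on `L'`
(`IsSurgery.isoTransport` at the final stage `t = 1`). Rolfsen (1976), §9.F; Gompf–Stipsicz
(1999), §5.3. [cite: Rolfsen1976, §9.F] -/
theorem IsSurgery.of_isIsotopic' {EY HY : Type*} [NormedAddCommGroup EY] [NormedSpace ℝ EY]
    [TopologicalSpace HY] {IY : ModelWithCorners ℝ EY HY} {Y : Type*} [TopologicalSpace Y]
    [ChartedSpace HY Y] {ι : Type*} [Finite ι] {L L' : FramedLink ι} (h : L.IsSurgery IY Y)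
    (hiso : L.IsIsotopic L') : L'.IsSurgery IY Y := by
  obtain ⟨⟨F, hF⟩, hfr⟩ := hiso
  exact h.isoTransport F 1 (fun i x ↦ congrFun (hF i) x) hfr

/-- Discharge of the named fact `FramedLink.IsSurgery.of_isIsotopic` (`KirbyMoves.lean`, leaf (I)
of the decomposition of `KirbyEquivalent.nonempty_diffeomorph` in `KirbyMovesSurgery.lean`):
**surgery depends only on the isotopy class of the framed link**. Rolfsen (1976), §9.F;
Gompf–Stipsicz (1999), §5.3. [cite: Rolfsen1976, §9.F] -/
theorem IsSurgery.of_isIsotopic_holds : IsSurgery.of_isIsotopic.{u, v, w, u'} :=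
  fun h hiso ↦ h.of_isIsotopic' hiso

end FramedLink

/-! ## The same for a framed knot: discharge of `IsIntegralSurgery.of_isIsotopic` -/

namespace Knot

/-- A stage of an ambient isotopy carrying the knot `K` to `K'` restricts to a diffeomorphism of
the knot complements; here its inverse `S³ ∖ K' → S³ ∖ K`, as a diffeomorphism of the open
submanifolds (knot version of `Link.isoComplDiffeo`). [folklore] -/
def isoComplDiffeo (F : AmbientIsotopy (𝓡 3) (𝕊 3)) (t : ℝ) {K K' : Knot}
    (hK : ∀ x, F.toFun t (K x) = K' x) : K'.complement ≃ₘ⟮𝓡 3, 𝓡 3⟯ K.complement where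
  toFun a := ⟨(F.toDiffeomorph t).symm a, by
    rw [SphereEmbedding.mem_complement_iff]
    rintro ⟨y, hy⟩
    have := congrArg (F.toDiffeomorph t) hy
    rw [Diffeomorph.apply_symm_apply, AmbientIsotopy.coe_toDiffeomorph, hK] at this
    exact a.2 ⟨y, this⟩⟩
  invFun a := ⟨F.toDiffeomorph t a, by
    rw [SphereEmbedding.mem_complement_iff]
    rintro ⟨y, hy⟩
    rw [AmbientIsotopy.coe_toDiffeomorph, ← hK] at hy
    exact a.2 ⟨y, (F.bijective t).1 hy⟩⟩
  left_inv a := Subtype.ext ((F.toDiffeomorph t).apply_symm_apply _)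
  right_inv a := Subtype.ext ((F.toDiffeomorph t).symm_apply_apply _)
  contMDiff_toFun := (ContMDiff.subtypeVal_comp_iff K.complement _).1
    ((F.toDiffeomorph t).symm.contMDiff.comp contMDiff_subtype_val)
  contMDiff_invFun := (ContMDiff.subtypeVal_comp_iff K'.complement _).1
    ((F.toDiffeomorph t).contMDiff.comp contMDiff_subtype_val)

/-- The knot complement diffeomorphism on points: it is `(F t)⁻¹`. [folklore] -/
@[simp] theorem coe_isoComplDiffeo_apply (F : AmbientIsotopy (𝓡 3) (𝕊 3)) (t : ℝ) {K K' : Knot}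
    (hK : ∀ x, F.toFun t (K x) = K' x) (a : K'.complement) :
    (isoComplDiffeo F t hK a : 𝕊 3) = (F.toDiffeomorph t).symm a := rfl

/-- Precomposing with the knot complement diffeomorphism does not change the image. [folklore] -/
theorem range_comp_isoComplDiffeo {Y : Type*} (F : AmbientIsotopy (𝓡 3) (𝕊 3)) (t : ℝ)
    {K K' : Knot} (hK : ∀ x, F.toFun t (K x) = K' x) (f : K.complement → Y) :
    range (f ∘ isoComplDiffeo F t hK) = range f :=
  (EquivLike.surjective (isoComplDiffeo F t hK)).range_comp f

end Knot

section KnotSurgery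

variable {EY HY : Type*} [NormedAddCommGroup EY] [NormedSpace ℝ EY] [TopologicalSpace HY]
  {IY : ModelWithCorners ℝ EY HY} {Y : Type*} [TopologicalSpace Y] [ChartedSpace HY Y]

/-- **`m`-surgery on a knot is transported along a stage of an ambient isotopy** (same manifold,
same model): if `Y` is `m`-surgery on `K` and `F t ∘ K = K'`, then `Y` is `m`-surgery on `K'`
(transport the tubular neighbourhood by `Knot.TubularNbhd.isoTransport` — oriented by
`det_pos_isoStage`, framing `m` by `HasFraming.isoTransport` — and precompose the embedding of
the knot complement with `(F t)⁻¹`). Rolfsen (1976), §9.F; Gompf–Stipsicz (1999), §5.3.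
[cite: Rolfsen1976, §9.F] -/
theorem IsIntegralSurgery.isoTransport {K K' : Knot} {m : ℤ} (h : IsIntegralSurgery IY Y K m)
    (F : AmbientIsotopy (𝓡 3) (𝕊 3)) (t : ℝ) (hK : ∀ x, F.toFun t (K x) = K' x) :
    IsIntegralSurgery IY Y K' m := by
  obtain ⟨ν, hν, jA, jB, hA, hAo, hB, hBo, hU, hR⟩ := h
  refine ⟨ν.isoTransport F t hK, Knot.TubularNbhd.HasFraming.isoTransport ν F t hK hν,
    jA ∘ Knot.isoComplDiffeo F t hK, jB, hA.comp_diffeomorph _, ?_, hB, hBo, ?_, fun a b ↦ ?_⟩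
  · rw [Knot.range_comp_isoComplDiffeo]
    exact hAo
  · rw [Knot.range_comp_isoComplDiffeo]
    exact hU
  · rw [comp_apply, hR (Knot.isoComplDiffeo F t hK a) b]
    change ν.glueRel ((F.toDiffeomorph t).symm a) b ↔ (ν.isoTransport F t hK).glueRel a b
    constructor
    · rintro ⟨u, s, hs, hb, ha⟩
      refine ⟨u, s, hs, hb, ?_⟩
      have := congrArg (F.toDiffeomorph t) ha
      rwa [Diffeomorph.apply_symm_apply] at this
    · rintro ⟨u, s, hs, hb, ha⟩
      refine ⟨u, s, hs, hb, ?_⟩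
      rw [Knot.TubularNbhd.isoTransport_apply, ← AmbientIsotopy.coe_toDiffeomorph] at ha
      rw [ha, Diffeomorph.symm_apply_apply]

/-- Discharge of the named fact `IsIntegralSurgery.of_isIsotopic` (`DehnSurgery.lean`):
**surgery depends only on the knot type** — if `Y` is `m`-surgery on `K` and `K'` is isotopic to
`K` (ambient isotopy of `S³` with `F 1 ∘ K = K'`), then `Y` is `m`-surgery on `K'`
(`IsIntegralSurgery.isoTransport` at `t = 1`). Rolfsen (1976), §9.F; Gompf–Stipsicz (1999), §5.3.
[cite: Rolfsen1976, §9.F] -/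
theorem IsIntegralSurgery.of_isIsotopic_holds : IsIntegralSurgery.of_isIsotopic (IY := IY) (Y := Y) := by
  intro K K' m h hK
  obtain ⟨F, hF⟩ := hK
  exact h.isoTransport F 1 fun x ↦ congrFun hF x

end KnotSurgery

end Literature.Topology.FourManifolds
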